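import Summits.QuantumFields.YangMills.Theorems.UnitScaleTiltProp8ChartDiff
import Summits.QuantumFields.YangMills.Theorems.UnitScaleTiltFluctuationComparisonRegPrLiftLegsGauge
import Literature.MathematicalPhysics.QuantumFieldTheory.Balaban1983to89.BlockAveragingEMLLinearised
import Literature.MathematicalPhysics.QuantumFieldTheory.Balaban1983to89.BlockAveragingEMLProp2
import HarnessLib

/-!
# Route `UnitScaleTilt`, crux K1 «MinimiserStabilityRegPr» (stmt-QuantumFields-19200), leaf V2′ `stub_halvingStep` — pillar P3 `ChartPerLevel`:
# **THE LINEARISED MULTI-LEVEL (0.4)-CONSTRAINT IN THE CHART IS `η·Q^{(j)}`** (`fderiv_chartLog_zero_apply`)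

Cell `ym3-torus` ∕ fleet seat `ym-ust-19200-p2` g6 (v8 PEN).  The P3 text `Prop8Chart.ChartRemainderAt` (p539223) is written with the ABSTRACT
derivative `fderiv ℂ (chartLog η D) 0` of the multi-level constraint map `chartLog η D A (j, c) = (−i)·log((Ū^{(j)}(e^{iηA}))(c))` (p535818/p537779;
an honest derivative by p540989).  This file COMPUTES it: for every level `j` and index bond `c`,
`fderiv ℂ (chartLog η D) 0 Y (j, c) = η·(Q^{(j)}Y)(c)`, where `Q^{(j)} = Q₁∘⋯∘Q₁` is the `j`-fold composite of the linearised one-step (0.4) average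
`Q₁ = BlockAveragingEMLLinearised.linAvg` (= `L·bondAvg − d(combMean)`, p482040; `Q^{(k)} = L^k·bondAvgIter k − dΛ_k`, p522364) — the family
`Q^{(j)}` is CHARACTERISED (`Q 0 = id`, `Q (i+1) = linAvg ∘ Q i`) exactly as in p519475/p521175, not defined.  So the `Qlin` of the F4 pen's
`chart47_dom`, pinned by P3 to `fderiv ℂ (chartLog η D) 0`, IS print's `LʲηQ_j` of [Balaban1985Variational] (45)/(156) up to the coarse pure gauge
`η·dΛ_j` (junction G3 of the vet), and the k-uniform right inverse of p521175 (`exists_rightInverse_iterLin`, constant ONE) is a right inverse of the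
chart's linearisation level by level (`exists_fderiv_chartLog_zero_eq_level`).
HOW (the chain rule at the flat point, for configurations in the units of ANY complete normed `ℂ`-algebra `𝔸`):
* §1 signed sums `walkSum` of operator-valued bond fields evaluate termwise; `walkSum`/`linAvg` commute with scalars; the (0.4) loop word's signed
  sum splits into the three segments of `linAvg` minus the straight line of `c` (`walkSum_walk_loopWord`);
* §2 `hasFDerivAt_coe_holT_flat`: the transport along a word of a family `F x` of fields, differentiable in `x` with bond derivatives `F′ b` at a
  point `x₀` where `F x₀ ≡ 1`, has derivative the signed sum `walkSum F′ (walk y w)` (product rule at `1·1`, `D(u ↦ u⁻¹)(1) = −id`);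
* §3 `hasFDerivAt_coe_emlAvgU_flat`: hence the UNGUARDED (0.4) average `emlAvgU (F x) c` has derivative
  `|I|⁻¹ Σ_{(n,σ,σ′)} [F′(Γ^σ) + F′([x,x′]) − F′(Γ^{σ′})]` (`D eml(1) = mean`, `BlockAveragingEMLAnalyticMean.hasFDerivAt_eml_one`; the `−c` segment
  of the loops cancels the straight transporter's derivative) — for matrix algebras `= linAvg (b ↦ F′ b ·) c`;
* §4 induction over the levels for `A ↦ Ū^{(i)}(e^{iηA})` at `A = 0` (derivative `(iη)·Q^{(i)}`), then `(−i)·log` at `1` (`B7TransferAnalyticMean.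
  hasFDerivAt_mlog_one`) and assembly over the index set `BondIdx D` (`hasFDerivAt_pi`): **`fderiv_chartLog_zero_apply`**, `fderiv_chartQ_zero_apply`
  (tree normalisation: `L^{−j}·Q^{(j)}`), and the level-wise right inverse.
Sorry-free, definition-free; no estimate.  NOT a claim about the mass gap.

References: T. Bałaban, CMP **102** (1985) 277–309 [Balaban1985Variational] ((44)–(48) p.285, (152)–(157) pp.301–302); CMP **98** (1985) 17–51
[Balaban1985Averaging] (Prop. 3 (122)–(125) p.36); CMP **109** (1987) 249–301 [Balaban1987RG1] ((0.3)–(0.4) pp.252–253, (0.21) p.256).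
-/

noncomputable section

open scoped BigOperators
open NormedSpace

namespace Summit.QuantumFields.YangMills.Theorems.Prop8Chart

open Literature.MathematicalPhysics.QuantumFieldTheory.Balaban1983to89
open T4Continuum BlockAveraging ExpMeanLog MatrixLog BlockAveragingEMLLinearised
open B7TransferAnalyticMean (meanCLM meanCLM_apply hasFDerivAt_mlog_one)
open BlockAveragingEMLAnalyticMean (hasFDerivAt_eml_one)
open B10Eq27TorusAxialLog (holT holT_nil holT_cons_true holT_cons_false holT_one)
open B6SectADomainsV1 (Domains)
open B6SectAOperatorsV1 (BondIdx)
open Summit.QuantumFields.YangMills.Theorems.ApproxLift (walkSum_walk_wordRev)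

variable {P : Params} {j : ℕ}

/-! ## §1 Signed sums: evaluation, scalars, the loop word -/

section Sums

variable {V : Type*} [AddCommGroup V]

/-- `walkSum` commutes with scalars: `(a·Y)(Γ) = a·Y(Γ)`. [cite: Balaban1984PropagatorsI, (1.8) p.19] -/
theorem walkSum_const_smul {R : Type*} [Monoid R] [DistribMulAction R V] (a : R) (Y : PBond P j → V) :
    ∀ γ : List (LStep P j), walkSum (fun b => a • Y b) γ = a • walkSum Y γ
  | [] => by simp [walkSum_nil]
  | s :: γ => by
    rw [walkSum_cons, walkSum_cons, walkSum_const_smul a Y γ, smul_add]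
    split_ifs <;> simp [smul_neg]

variable {E : Type*} [NormedAddCommGroup E] [NormedSpace ℂ E] {W : Type*} [NormedAddCommGroup W] [NormedSpace ℂ W]

/-- **OPERATOR-VALUED SIGNED SUMS EVALUATE TERMWISE**: for a field of continuous linear maps `F′ b : E →L[ℂ] W`,
`(walkSum F′ Γ) v = walkSum (b ↦ F′ b v) Γ`. [cite: Balaban1984PropagatorsI, (1.8) p.19] -/
theorem walkSum_apply (F' : PBond P j → (E →L[ℂ] W)) (v : E) :
    ∀ γ : List (LStep P j), (walkSum F' γ) v = walkSum (fun b => F' b v) γ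
  | [] => by simp [walkSum_nil]
  | s :: γ => by
    rw [walkSum_cons, walkSum_cons, add_apply, walkSum_apply F' v γ]
    split_ifs <;> simp

/-- `(−c)`: the signed sum along the straight walk of `L` steps `−e_μ` from `emb c₊` is minus the one along the straight line of `c` from `emb c₋`.
[cite: Balaban1987RG1, (0.4) p.253] -/
theorem walkSum_walk_replicate_false_tgt (Y : PBond P j → V) (c : PBond P (j + 1)) :
    walkSum Y (walk (emb c.tgt) (List.replicate P.L (c.dir, false))) = -walkSum Y (walk (emb c.src) (List.replicate P.L (c.dir, true))) := by
  have h1 : List.replicate P.L (c.dir, false) = wordRev (List.replicate P.L (c.dir, true)) := by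
    rw [wordRev_replicate]; rfl
  rw [h1, show emb c.tgt = walkEnd (emb c.src) (List.replicate P.L (c.dir, true)) from (walkEnd_replicate_L c.src c.dir).symm,
    walkSum_walk_wordRev]

/-- **THE SIGNED SUM ALONG THE (0.4) LOOP WORD `Γ ∪ [x,x′] ∪ (−Γ′) ∪ (−c)` SPLITS INTO ITS FOUR SEGMENTS**:
`Y(loop_i) = Y(Γ^σ_{y→x}) + Y([x,x′]) − Y(Γ^{σ′}_{y′→x′}) − Y([y, y′]_L)` — the three segments of `linAvg` and the straight line of `c`.
[cite: Balaban1987RG1, (0.4) p.253; Balaban1985Averaging, (124)-(125) p.36] -/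
theorem walkSum_walk_loopWord (Y : PBond P j → V) (c : PBond P (j + 1)) (i : Idx P) :
    walkSum Y (walk (emb c.src) (loopWord P.L c.dir (off i.1) i.2.1 i.2.2)) =
      walkSum Y (walk (emb c.src) (stairWord i.2.1 (off i.1))) +
        walkSum Y (walk (walkEnd (emb c.src) (stairWord i.2.1 (off i.1))) (List.replicate P.L (c.dir, true))) -
        walkSum Y (walk (emb c.tgt) (stairWord i.2.2 (off i.1))) -
        walkSum Y (walk (emb c.src) (List.replicate P.L (c.dir, true))) := by
  unfold loopWord
  rw [walk_append, walkSum_append, walk_append, walkSum_append, walk_append, walkSum_append,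
    BlockAveragingEMLProp2.walkEnd_stairWord_replicate c.src c.dir i.2.1 i.2.2 (off i.1),
    show c.src.shift c.dir = c.tgt from rfl, walkSum_walk_wordRev, walkEnd_walkEnd_wordRev, walkSum_walk_replicate_false_tgt]
  abel

variable {n : Type*}

/-- `linAvg` commutes with scalars. [cite: Balaban1985Averaging, (124)-(125) p.36] -/
theorem linAvg_const_smul (a : ℂ) (Y : PBond P j → Matrix n n ℂ) (c : PBond P (j + 1)) :
    linAvg (fun b => a • Y b) c = a • linAvg Y c := by
  rw [linAvg_def, linAvg_def]
  simp only [walkSum_const_smul, ← smul_add, ← smul_sub]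
  rw [← Finset.smul_sum, smul_comm]

end Sums

/-! ## §2 Transports of a differentiable family at a flat point -/

section Flat

variable {𝔸 : Type*} [NormedRing 𝔸] [NormedAlgebra ℂ 𝔸] [CompleteSpace 𝔸]
variable {E : Type*} [NormedAddCommGroup E] [NormedSpace ℂ E]

/-- **THE DERIVATIVE OF A TRANSPORT AT THE FLAT CONFIGURATION IS THE SIGNED SUM OF THE BOND DERIVATIVES**: if every bond variable of
`F x : GaugeField P j 𝔸ˣ` (read in `𝔸`) has derivative `F′ b` at `x₀` and `F x₀ ≡ 1`, then `x ↦ holT (F x) y w` has derivative `walkSum F′ (walk y w)`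
at `x₀` (product rule at `1·1`; `D(u ↦ u⁻¹)(1) = −id`). [cite: Balaban1985Averaging, (9) p.18, (122)-(123) p.36] -/
theorem hasFDerivAt_coe_holT_flat {F : E → GaugeField P j 𝔸ˣ} {x₀ : E} {F' : PBond P j → (E →L[ℂ] 𝔸)}
    (hF : ∀ b : PBond P j, HasFDerivAt (fun x => ((F x b : 𝔸ˣ) : 𝔸)) (F' b) x₀) (h1 : ∀ b, F x₀ b = 1) :
    ∀ (w : List (Letter P.d)) (y : Site P j), HasFDerivAt (fun x => ((holT (F x) y w : 𝔸ˣ) : 𝔸)) (walkSum F' (walk y w)) x₀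
  | [], y => by
    simp only [holT_nil, Units.val_one, walk, walkSum_nil]
    exact hasFDerivAt_const (1 : 𝔸) x₀
  | (μ, true) :: w, y => by
    have ih := hasFDerivAt_coe_holT_flat hF h1 w (y.shift μ)
    have hflat : F x₀ = fun _ => 1 := funext h1
    have hfun : (fun x => ((holT (F x) y ((μ, true) :: w) : 𝔸ˣ) : 𝔸)) =
        (fun x => ((F x ⟨y, μ⟩ : 𝔸ˣ) : 𝔸)) * fun x => ((holT (F x) (y.shift μ) w : 𝔸ˣ) : 𝔸) := by
      funext x; simp only [Pi.mul_apply, holT_cons_true, Units.val_mul]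
    rw [hfun]
    refine ((hF ⟨y, μ⟩).mul' ih).congr_fderiv ?_
    have hA : ((F x₀ ⟨y, μ⟩ : 𝔸ˣ) : 𝔸) = 1 := by rw [h1, Units.val_one]
    have hB : ((holT (F x₀) (y.shift μ) w : 𝔸ˣ) : 𝔸) = 1 := by rw [hflat, holT_one, Units.val_one]
    ext v
    simp only [add_apply, hA, hB, one_smul, MulOpposite.op_one, walk, walkSum_cons, if_true]
    exact add_comm _ _
  | (μ, false) :: w, y => by
    have ih := hasFDerivAt_coe_holT_flat hF h1 w (y.unshift μ)
    have hflat : F x₀ = fun _ => 1 := funext h1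
    have hfun : (fun x => ((holT (F x) y ((μ, false) :: w) : 𝔸ˣ) : 𝔸)) =
        (Ring.inverse ∘ fun x => ((F x ⟨y.unshift μ, μ⟩ : 𝔸ˣ) : 𝔸)) * fun x => ((holT (F x) (y.unshift μ) w : 𝔸ˣ) : 𝔸) := by
      funext x; simp [holT_cons_false, Units.val_mul]
    rw [hfun]
    have hinv : HasFDerivAt (Ring.inverse ∘ fun x => ((F x ⟨y.unshift μ, μ⟩ : 𝔸ˣ) : 𝔸))
        ((-ContinuousLinearMap.mulLeftRight ℂ 𝔸 ((F x₀ ⟨y.unshift μ, μ⟩)⁻¹ : 𝔸ˣ) ((F x₀ ⟨y.unshift μ, μ⟩)⁻¹ : 𝔸ˣ)).comp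
          (F' ⟨y.unshift μ, μ⟩)) x₀ :=
      (hasFDerivAt_ringInverse (𝕜 := ℂ) (F x₀ ⟨y.unshift μ, μ⟩)).comp x₀ (hF ⟨y.unshift μ, μ⟩)
    refine (hinv.mul' ih).congr_fderiv ?_
    have hA : (F x₀ ⟨y.unshift μ, μ⟩ : 𝔸ˣ) = 1 := h1 _
    have hB : ((holT (F x₀) (y.unshift μ) w : 𝔸ˣ) : 𝔸) = 1 := by rw [hflat, holT_one, Units.val_one]
    ext v
    simp only [add_apply, Function.comp_apply, hA, hB, inv_one, Units.val_one,
      Ring.inverse_one, one_smul, MulOpposite.op_one, ContinuousLinearMap.comp_apply, neg_apply,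
      ContinuousLinearMap.mulLeftRight_apply, one_mul, mul_one, walk, walkSum_cons, Bool.false_eq_true, if_false]
    exact add_comm _ _

/-! ## §3 The unguarded (0.4) average of a differentiable family at a flat point -/

/-- The mean of a constant family of vectors is the constant (`|I| ≥ 1`). [folklore] -/
theorem card_inv_smul_sum_const {ι : Type*} [Fintype ι] [Nonempty ι] {M : Type*} [AddCommGroup M] [Module ℂ M] (X : M) :
    ((Fintype.card ι : ℂ))⁻¹ • ∑ _i : ι, X = X := by
  have hc : (Fintype.card ι : ℂ) ≠ 0 := Nat.cast_ne_zero.mpr Fintype.card_pos.ne'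
  rw [Finset.sum_const, Finset.card_univ, ← Nat.cast_smul_eq_nsmul ℂ, smul_smul, inv_mul_cancel₀ hc, one_smul]

/-- **THE DERIVATIVE OF THE UNGUARDED (0.4) AVERAGE AT THE FLAT CONFIGURATION** (raw form): with `F`, `F′`, `x₀` as in
`hasFDerivAt_coe_holT_flat`, `x ↦ (emlAvgU (F x))(c)` has derivative `mean_i F′(loop_i) + F′([y, y′]_L)` at `x₀` (`D eml(1) =` arithmetic mean,
product rule at `1·1`). [cite: Balaban1987RG1, (0.4) p.253; Balaban1985Averaging, (122)-(125) p.36] -/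
theorem hasFDerivAt_coe_emlAvgU_flat_raw {F : E → GaugeField P j 𝔸ˣ} {x₀ : E} {F' : PBond P j → (E →L[ℂ] 𝔸)}
    (hF : ∀ b : PBond P j, HasFDerivAt (fun x => ((F x b : 𝔸ˣ) : 𝔸)) (F' b) x₀) (h1 : ∀ b, F x₀ b = 1) (c : PBond P (j + 1)) :
    HasFDerivAt (fun x => ((emlAvgU (F x) c : 𝔸ˣ) : 𝔸))
      ((meanCLM (Idx P) 𝔸).comp (ContinuousLinearMap.pi fun i : Idx P =>
          walkSum F' (walk (emb c.src) (loopWord P.L c.dir (off i.1) i.2.1 i.2.2))) +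
        walkSum F' (walk (emb c.src) (List.replicate P.L (c.dir, true)))) x₀ := by
  have hflat : F x₀ = fun _ => 1 := funext h1
  have hfun : (fun x => ((emlAvgU (F x) c : 𝔸ˣ) : 𝔸)) =
      (fun x => eml (fun i : Idx P => ((loopHolU (F x) c i : 𝔸ˣ) : 𝔸))) *
        fun x => ((holT (F x) (emb c.src) (List.replicate P.L (c.dir, true)) : 𝔸ˣ) : 𝔸) := by
    funext x; rw [Pi.mul_apply]; exact coe_emlAvgU (F x) c
  rw [hfun]
  -- the loop family and its derivative
  have hloops : HasFDerivAt (fun x => fun i : Idx P => ((loopHolU (F x) c i : 𝔸ˣ) : 𝔸))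
      (ContinuousLinearMap.pi fun i : Idx P => walkSum F' (walk (emb c.src) (loopWord P.L c.dir (off i.1) i.2.1 i.2.2))) x₀ :=
    hasFDerivAt_pi.mpr fun i => by unfold loopHolU; exact hasFDerivAt_coe_holT_flat hF h1 _ _
  have hloops1 : (fun i : Idx P => ((loopHolU (F x₀) c i : 𝔸ˣ) : 𝔸)) = 1 := by
    funext i; rw [hflat, loopHolU, holT_one, Units.val_one, Pi.one_apply]
  have heml : HasFDerivAt (eml : (Idx P → 𝔸) → 𝔸) (meanCLM (Idx P) 𝔸) (fun i : Idx P => ((loopHolU (F x₀) c i : 𝔸ˣ) : 𝔸)) := by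
    rw [hloops1]; exact hasFDerivAt_eml_one
  have hcomp := heml.comp x₀ hloops
  have hstraight := hasFDerivAt_coe_holT_flat hF h1 (List.replicate P.L (c.dir, true)) (emb c.src)
  refine (hcomp.mul' hstraight).congr_fderiv ?_
  have hA : eml (fun i : Idx P => ((loopHolU (F x₀) c i : 𝔸ˣ) : 𝔸)) = 1 := by rw [hloops1]; exact eml_const_one
  have hB : ((holT (F x₀) (emb c.src) (List.replicate P.L (c.dir, true)) : 𝔸ˣ) : 𝔸) = 1 := by rw [hflat, holT_one, Units.val_one]
  ext v
  simp only [add_apply, Function.comp_apply, hA, hB, one_smul, MulOpposite.op_one]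
  exact add_comm _ _

/-- **THE DERIVATIVE OF THE UNGUARDED (0.4) AVERAGE AT THE FLAT CONFIGURATION IS THE LINEARISED AVERAGE OF THE BOND DERIVATIVES**:
`D[(emlAvgU (F ·))(c)](x₀) = |I|⁻¹ Σ_{(n,σ,σ′)} [F′(Γ^σ_{y→x}) + F′([x,x′]) − F′(Γ^{σ′}_{y′→x′})]` — the `linAvg` expression on operator-valued fields
(the `−c` segments of the loops cancel the straight transporter's derivative). [cite: Balaban1985Averaging, (124)-(125) p.36; Balaban1987RG1, (0.4) p.253] -/
theorem hasFDerivAt_coe_emlAvgU_flat {F : E → GaugeField P j 𝔸ˣ} {x₀ : E} {F' : PBond P j → (E →L[ℂ] 𝔸)}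
    (hF : ∀ b : PBond P j, HasFDerivAt (fun x => ((F x b : 𝔸ˣ) : 𝔸)) (F' b) x₀) (h1 : ∀ b, F x₀ b = 1) (c : PBond P (j + 1)) :
    HasFDerivAt (fun x => ((emlAvgU (F x) c : 𝔸ˣ) : 𝔸))
      (((Fintype.card (Idx P) : ℂ))⁻¹ • ∑ i : Idx P,
        (walkSum F' (walk (emb c.src) (stairWord i.2.1 (off i.1))) +
          walkSum F' (walk (walkEnd (emb c.src) (stairWord i.2.1 (off i.1))) (List.replicate P.L (c.dir, true))) -
          walkSum F' (walk (emb c.tgt) (stairWord i.2.2 (off i.1))))) x₀ := by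
  refine (hasFDerivAt_coe_emlAvgU_flat_raw hF h1 c).congr_fderiv ?_
  ext v
  simp only [add_apply, ContinuousLinearMap.comp_apply, meanCLM_apply, ContinuousLinearMap.pi_apply,
    smul_apply, sum_apply, sub_apply, walkSum_walk_loopWord]
  rw [Finset.sum_sub_distrib, smul_sub, card_inv_smul_sum_const, sub_add_cancel]

end Flat

/-! ## §4 The charted configuration: level by level at `A = 0`, then `chartLog` -/

section Chart

open scoped Matrix.Norms.L2Operator

variable {n : Type*} [Fintype n] [DecidableEq n]

/-- **THE CHARTED BOND VARIABLE TO FIRST ORDER**: `A ↦ e^{iηA(b)}` has derivative `Y ↦ (iη)·Y(b)` at `A = 0`. [cite: Balaban1985Variational, (152) p.301] -/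
theorem hasFDerivAt_coe_expCfg_zero {𝔸 : Type*} [NormedRing 𝔸] [NormedAlgebra ℂ 𝔸] [CompleteSpace 𝔸] (η : ℝ) (b : PBond P 0) :
    HasFDerivAt (fun A : PBond P 0 → 𝔸 => ((expCfg η A b : 𝔸ˣ) : 𝔸))
      ((Complex.I * (η : ℂ)) • ContinuousLinearMap.proj (R := ℂ) (φ := fun _ : PBond P 0 => 𝔸) b) 0 := by
  set ℓ : (PBond P 0 → 𝔸) →L[ℂ] 𝔸 := (Complex.I * (η : ℂ)) • ContinuousLinearMap.proj (R := ℂ) (φ := fun _ : PBond P 0 => 𝔸) b with hℓ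
  have hfun : (fun A : PBond P 0 → 𝔸 => ((expCfg η A b : 𝔸ˣ) : 𝔸)) = fun A => exp (ℓ A) := by
    funext A; rw [coe_expCfg]; rfl
  rw [hfun]
  have hexp : HasFDerivAt (exp : 𝔸 → 𝔸) (1 : 𝔸 →L[ℂ] 𝔸) (ℓ 0) := by rw [map_zero]; exact hasFDerivAt_exp_zero
  have h := hexp.comp (0 : PBond P 0 → 𝔸) ℓ.hasFDerivAt
  rwa [ContinuousLinearMap.one_def, ContinuousLinearMap.id_comp] at h

/-- **LEVEL BY LEVEL: `D[Ū^{(i)}(e^{iηA})(c)](0) = (iη)·Q^{(i)}(·)(c)`** for any family `Q^{(i)}` with `Q^{(0)} = id`, `Q^{(i+1)} = linAvg ∘ Q^{(i)}`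
(induction over the levels with §3; at `A = 0` every iterate is the flat field). [cite: Balaban1985Averaging, Prop. 3 (124)-(125) p.36, Prop. 4 p.38;
Balaban1987RG1, (0.21) p.256] -/
theorem exists_hasFDerivAt_coe_emlIterU_expCfg_zero (η : ℝ)
    (Q : (i : ℕ) → (PBond P 0 → Matrix n n ℂ) → PBond P i → Matrix n n ℂ)
    (hQ0 : ∀ Y, Q 0 Y = Y) (hQs : ∀ (i : ℕ) (Y : PBond P 0 → Matrix n n ℂ) (c : PBond P (i + 1)), Q (i + 1) Y c = linAvg (Q i Y) c) :
    ∀ (i : ℕ) (c : PBond P i), ∃ D : (PBond P 0 → Matrix n n ℂ) →L[ℂ] Matrix n n ℂ,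
      HasFDerivAt (fun A : PBond P 0 → Matrix n n ℂ => ((emlIterU i (expCfg η A) c : (Matrix n n ℂ)ˣ) : Matrix n n ℂ)) D 0 ∧
        ∀ Y, D Y = (Complex.I * (η : ℂ)) • Q i Y c := by
  intro i
  induction i with
  | zero =>
    intro b
    refine ⟨(Complex.I * (η : ℂ)) • ContinuousLinearMap.proj (R := ℂ) (φ := fun _ : PBond P 0 => Matrix n n ℂ) b, ?_, fun Y => ?_⟩
    · simpa only [emlIterU_zero] using hasFDerivAt_coe_expCfg_zero (P := P) (𝔸 := Matrix n n ℂ) η b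
    · rw [hQ0]; rfl
  | succ i ih =>
    intro c
    choose D hD hDQ using ih
    have h1 : ∀ b : PBond P i, emlIterU i (expCfg η (0 : PBond P 0 → Matrix n n ℂ)) b = 1 := fun b => by
      rw [expCfg_zero, emlIterU_one]
    have h := hasFDerivAt_coe_emlAvgU_flat (F := fun A : PBond P 0 → Matrix n n ℂ => emlIterU i (expCfg η A)) (F' := D) hD h1 c
    refine ⟨_, by simpa only [emlIterU_succ] using h, fun Y => ?_⟩
    simp only [smul_apply, sum_apply, add_apply, sub_apply,
      walkSum_apply, hDQ]
    rw [← linAvg_def (fun b => (Complex.I * (η : ℂ)) • Q i Y b) c, linAvg_const_smul, hQs]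

/-- **THE LINEARISED MULTI-LEVEL (0.4)-CONSTRAINT IN PRINT'S READING IS `η·Q^{(j)}`**: for every nested family `D`, every `η` and every index
`(j, c) ∈ BondIdx D`, `fderiv ℂ (chartLog η D) 0 Y (j, c) = η·(Q^{(j)}Y)(c)` (`Q^{(j)}` characterised as in
`exists_hasFDerivAt_coe_emlIterU_expCfg_zero`; `D log(1) = id`, `(−i)(iη) = η`) — the `Qlin` of `chart47_dom` pinned by the P3 text IS print's
`LʲηQ_j` up to the coarse pure gauge `η·dΛ_j` (p522364). [cite: Balaban1985Variational, (45) p.285, (156)-(157) p.302] -/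
theorem fderiv_chartLog_zero_apply (η : ℝ) (D : Domains P)
    (Q : (i : ℕ) → (PBond P 0 → Matrix n n ℂ) → PBond P i → Matrix n n ℂ)
    (hQ0 : ∀ Y, Q 0 Y = Y) (hQs : ∀ (i : ℕ) (Y : PBond P 0 → Matrix n n ℂ) (c : PBond P (i + 1)), Q (i + 1) Y c = linAvg (Q i Y) c)
    (Y : PBond P 0 → Matrix n n ℂ) (idx : BondIdx D) :
    fderiv ℂ (chartLog η D : (PBond P 0 → Matrix n n ℂ) → BondIdx D → Matrix n n ℂ) 0 Y idx = (η : ℂ) • Q idx.1.1 Y idx.1.2 := by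
  choose Dm hDm hDmQ using fun idx : BondIdx D => exists_hasFDerivAt_coe_emlIterU_expCfg_zero (P := P) (n := n) η Q hQ0 hQs idx.1.1 idx.1.2
  -- per index: `(−i)·log` at `1`
  have hidx : ∀ idx : BondIdx D, HasFDerivAt (fun A : PBond P 0 → Matrix n n ℂ => chartLog η D A idx)
      ((-Complex.I) • ((1 : Matrix n n ℂ →L[ℂ] Matrix n n ℂ).comp (Dm idx))) 0 := by
    intro idx
    have hval : ((emlIterU (idx.1.1 : ℕ) (expCfg η (0 : PBond P 0 → Matrix n n ℂ)) idx.1.2 : (Matrix n n ℂ)ˣ) : Matrix n n ℂ) = 1 := by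
      rw [expCfg_zero, emlIterU_one, Units.val_one]
    have hlog : HasFDerivAt (mlog : Matrix n n ℂ → Matrix n n ℂ) (1 : Matrix n n ℂ →L[ℂ] Matrix n n ℂ)
        (((emlIterU (idx.1.1 : ℕ) (expCfg η (0 : PBond P 0 → Matrix n n ℂ))) idx.1.2 : (Matrix n n ℂ)ˣ) : Matrix n n ℂ) := by
      rw [hval]; exact hasFDerivAt_mlog_one
    exact ((hlog.comp (0 : PBond P 0 → Matrix n n ℂ) (hDm idx)).const_smul (-Complex.I))
  have hpi : HasFDerivAt (chartLog η D : (PBond P 0 → Matrix n n ℂ) → BondIdx D → Matrix n n ℂ)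
      (ContinuousLinearMap.pi fun idx : BondIdx D => (-Complex.I) • ((1 : Matrix n n ℂ →L[ℂ] Matrix n n ℂ).comp (Dm idx))) 0 :=
    hasFDerivAt_pi.mpr hidx
  rw [hpi.fderiv, ContinuousLinearMap.pi_apply, smul_apply, ContinuousLinearMap.comp_apply,
    one_apply_eq_self, hDmQ, smul_smul]
  congr 1
  rw [← mul_assoc, show -Complex.I * Complex.I = 1 by rw [neg_mul, Complex.I_mul_I, neg_neg], one_mul]

/-- The same in the tree's normalisation: `fderiv ℂ (chartQ η D) 0 Y (j, c) = L^{−j}·(Q^{(j)}Y)(c)` (`η ≠ 0`; `chartQ = (ηLʲ)⁻¹·chartLog`).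
[cite: Balaban1985Variational, (156) p.302; Balaban1984PropagatorsI, (1.18) p.20] -/
theorem fderiv_chartQ_zero_apply {η : ℝ} (hη : η ≠ 0) (D : Domains P)
    (Q : (i : ℕ) → (PBond P 0 → Matrix n n ℂ) → PBond P i → Matrix n n ℂ)
    (hQ0 : ∀ Y, Q 0 Y = Y) (hQs : ∀ (i : ℕ) (Y : PBond P 0 → Matrix n n ℂ) (c : PBond P (i + 1)), Q (i + 1) Y c = linAvg (Q i Y) c)
    (Y : PBond P 0 → Matrix n n ℂ) (idx : BondIdx D) :
    fderiv ℂ (chartQ η D : (PBond P 0 → Matrix n n ℂ) → BondIdx D → Matrix n n ℂ) 0 Y idx =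
      (((P.L : ℂ) ^ (idx.1.1 : ℕ))⁻¹) • Q idx.1.1 Y idx.1.2 := by
  have hfun : (chartQ η D : (PBond P 0 → Matrix n n ℂ) → BondIdx D → Matrix n n ℂ) =
      fun A idx => (((η : ℂ) * (P.L : ℂ) ^ (idx.1.1 : ℕ))⁻¹) • chartLog η D A idx := by
    funext A idx
    rw [chartLog_eq_smul_chartQ hη, smul_smul, inv_mul_cancel₀, one_smul]
    exact mul_ne_zero (Complex.ofReal_ne_zero.mpr hη) (pow_ne_zero _ (Nat.cast_ne_zero.mpr P.L_pos.ne'))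
  have hdiff := differentiableAt_chartLog_zero (P := P) (𝔸 := Matrix n n ℂ) η D
  have hidx : ∀ idx : BondIdx D, HasFDerivAt (fun A : PBond P 0 → Matrix n n ℂ => chartQ η D A idx)
      ((((η : ℂ) * (P.L : ℂ) ^ (idx.1.1 : ℕ))⁻¹) • ((ContinuousLinearMap.proj (R := ℂ) (φ := fun _ : BondIdx D => Matrix n n ℂ) idx).comp
        (fderiv ℂ (chartLog η D : (PBond P 0 → Matrix n n ℂ) → BondIdx D → Matrix n n ℂ) 0))) 0 := by
    intro idx
    rw [hfun]
    exact ((hasFDerivAt_pi'.mp hdiff.hasFDerivAt) idx).const_smul ((((η : ℂ) * (P.L : ℂ) ^ (idx.1.1 : ℕ))⁻¹ : ℂ))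
  have hpi := hasFDerivAt_pi.mpr hidx
  rw [show (fun (A : PBond P 0 → Matrix n n ℂ) (idx : BondIdx D) => chartQ η D A idx) = chartQ η D from rfl] at hpi
  rw [hpi.fderiv, ContinuousLinearMap.pi_apply, smul_apply, ContinuousLinearMap.comp_apply,
    ContinuousLinearMap.proj_apply, fderiv_chartLog_zero_apply η D Q hQ0 hQs, smul_smul]
  congr 1
  have hη' : (η : ℂ) ≠ 0 := Complex.ofReal_ne_zero.mpr hη
  field_simp

/-- **A RIGHT INVERSE OF THE CHART'S LINEARISATION, LEVEL BY LEVEL, WITH CONSTANT `η⁻¹`** ([Balaban1985Variational] (45)–(46) for the TRUE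
linearised constraint): for every level `j ≤ m + K`, every level-`j` field `B` with `‖B(c)‖ ≤ M` and `η ≠ 0` there is a finest-lattice `Y` with
`fderiv ℂ (chartLog η D) 0 Y (j, c) = B c` at EVERY index of level `j` and `‖Y(b)‖ ≤ |η|⁻¹·M` (p521175's far-face right inverse of `Q^{(j)}`,
constant one).  The simultaneous multi-level right inverse on `BondIdx D` (hH of `ChartRemainderAt`) needs the nestedness/separation of `D` and is
NOT claimed here. [cite: Balaban1985Variational, (45)-(46) p.285] -/
theorem exists_fderiv_chartLog_zero_eq_level {η : ℝ} (hη : η ≠ 0) (D : Domains P)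
    (Q : (i : ℕ) → (PBond P 0 → Matrix n n ℂ) → PBond P i → Matrix n n ℂ)
    (hQ0 : ∀ Y, Q 0 Y = Y) (hQs : ∀ (i : ℕ) (Y : PBond P 0 → Matrix n n ℂ) (c : PBond P (i + 1)), Q (i + 1) Y c = linAvg (Q i Y) c)
    (hQinv : ∀ k : ℕ, k ≤ P.m + P.K → ∀ (B : PBond P k → Matrix n n ℂ) (M : ℝ), 0 ≤ M → (∀ c, ‖B c‖ ≤ M) →
      ∃ Y : PBond P 0 → Matrix n n ℂ, (∀ c : PBond P k, Q k Y c = B c) ∧ ∀ b : PBond P 0, ‖Y b‖ ≤ M)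
    {k : ℕ} (hk : k ≤ P.m + P.K) (B : (i : ℕ) → PBond P i → Matrix n n ℂ) {M : ℝ} (hM : 0 ≤ M) (hB : ∀ c : PBond P k, ‖B k c‖ ≤ M) :
    ∃ Y : PBond P 0 → Matrix n n ℂ,
      (∀ idx : BondIdx D, (idx.1.1 : ℕ) = k →
        fderiv ℂ (chartLog η D : (PBond P 0 → Matrix n n ℂ) → BondIdx D → Matrix n n ℂ) 0 Y idx = B idx.1.1 idx.1.2) ∧
      ∀ b : PBond P 0, ‖Y b‖ ≤ |η|⁻¹ * M := by
  have hη' : (η : ℂ) ≠ 0 := Complex.ofReal_ne_zero.mpr hη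
  obtain ⟨Y, hYB, hYM⟩ := hQinv k hk (fun c => ((η : ℂ)⁻¹) • B k c) (|η|⁻¹ * M) (by positivity) fun c => by
    rw [norm_smul, norm_inv, Complex.norm_real, Real.norm_eq_abs]
    exact mul_le_mul_of_nonneg_left (hB c) (by positivity)
  refine ⟨Y, fun idx hj => ?_, hYM⟩
  rw [fderiv_chartLog_zero_apply η D Q hQ0 hQs]
  obtain ⟨⟨j, c⟩, hmem⟩ := idx
  simp only at hj ⊢
  subst hj
  rw [hYB, smul_smul, mul_inv_cancel₀ hη', one_smul]

end Chart

end Summit.QuantumFields.YangMills.Theorems.Prop8Chart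

end
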